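import Literature.Computability.Complexity.KRWComposition
import Literature.Computability.Complexity.CountingDiagonalization
import Literature.Computability.Complexity.CircuitComposition
import HarnessLib

/-!
# Depth-hard functions exist (Riordan–Shannon counting through Karchmer–Wigderson) — PROOF

Topic `Computability/Complexity`. This file DISCHARGES the named fact
`Literature.Computability.Complexity.DepthHardFunctionsExist` of `KRWComposition.lean`
(`DepthHardFunctionsExist_holds`): there is an absolute constant `c` such that for every `n ≥ 1`
some `g : {0,1}ⁿ → {0,1}` needs Karchmer–Wigderson protocols of depth `≥ n − c (log₂ n + 1)`.

The printed argument (Jukna, *Boolean Function Complexity* (2012), Thm. 1.23 — Riordan–Shannon /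
Shannon counting: almost all functions need large formulas/circuits — composed with Thm. 3.13,
Claim 3.15 — a depth-`d` protocol for the Karchmer–Wigderson game of `g` yields a De Morgan formula
of depth `d`, hence of leafsize `≤ 2ᵈ`) is followed with the tree's existing ingredients:

* §1 **Protocol ⟹ circuit, GENERAL game** (`KWTree.exists_cktSize_of_rectangle`,
  `KWTree.exists_circuit_of_solves`): the rectangle induction of Jukna Thm. 3.13 / Claim 3.15
  exactly as in the tree's monotone version `KWTree.exists_formula_of_rectangle`
  (`KWProtocolFormula.lean`: Alice nodes `∨`, Bob nodes `∧`, empty sub-rectangles pruned), the only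
  change being at the leaves: on a rectangle `A × B` where the protocol answers the coordinate `i`
  with `a i ≠ b i`, all `a ∈ A` agree at `i` and all `b ∈ B` carry the opposite bit, so the leaf
  becomes the LITERAL `x_i` or `¬x_i`. Circuits are built in the `CktSize` calculus of
  `CircuitComposition.lean` over the full binary basis `B2` (negations cost one gate, so a protocol
  of depth `d` gives a `B2`-circuit with at most `2^{d+1} − 1` gates; formula-ness is not needed).
* §2 **Counting** (`card_code_lt_two_pow_two_pow`): from the tree's code count
  `CircuitCount.card_code_le` (`#Code n S ≤ (S+1)(16(n+S+1)²)ˢ(n+S+1)`), for `n ≥ 9` and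
  `S + 2 = 2^{n − ⌊log₂ n⌋ − 4}` one has `#Code n S < 2^{2ⁿ}`, so the tree's greedy hard function
  `GreedyHard.hardFn n S` (`CountingDiagonalization.lean`) has `B2`-circuit complexity `> S`
  (`GreedyHard.lt_circuitSizeOver_hardFn`) — this is Riordan–Shannon's count in the circuit form
  already available in the tree (Jukna Thm. 1.23 is the sharper formula count; any
  `2ⁿ / poly(n)` bound suffices for the `O(log n)` loss).
* §3 **Assembly** (`DepthHardFunctionsExist_holds`, with `c = 8`): a protocol of depth `d` for the
  hard `g` gives `S < 2^{d+1} − 1`, i.e. `n − ⌊log₂ n⌋ − 4 ≤ d + 1`; lengths `n ≤ 8` are covered by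
  the constant. (`g` is not constant, since constants have `B2`-circuits of size `1 ≤ S`.)

No new definitions, no new named facts.

## References

* [JuknaBFC2012] S. Jukna, *Boolean Function Complexity*, Springer 2012: Thm. 1.23
  (Riordan–Shannon), §3.3 Thm. 3.13 and Claim 3.15 (protocol ⟹ formula).
* [KarchmerWigderson1990] M. Karchmer, A. Wigderson, SIAM J. Discrete Math. 3 (1990), §2.
-/

namespace Literature.Computability.Complexity

open Finset

/-! ### §1 Protocol ⟹ circuit for the general Karchmer–Wigderson game -/

namespace KWTree

variable {ι : Type*}

/-- **Karchmer–Wigderson, protocol ⟹ circuit, rectangle form, GENERAL game** (Jukna 2012,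
Thm. 3.13 / Claim 3.15, with empty sub-rectangles pruned as in the tree's monotone version
`exists_formula_of_rectangle`). If the protocol tree `P` is correct for the general game on a
rectangle `A × B` with both sides nonempty — on every `a ∈ A`, `b ∈ B` it outputs a coordinate `i`
with `a i ≠ b i` — then some Boolean function `F` with a `B2`-program of at most `2^{depth+1} − 1`
gates is `1` on `A` and `0` on `B`. Leaves become literals `x_i` / `¬x_i`, Alice nodes `∨`, Bob
nodes `∧`. [cite: JuknaBFC2012, §3.3, Thm. 3.13 and Claim 3.15 (protocol ⟹ formula)]
[cite: KarchmerWigderson1990, §2 (the relation R_f)] -/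
theorem exists_cktSize_of_rectangle :
    ∀ (P : KWTree ι) (A B : Set (ι → Bool)), A.Nonempty → B.Nonempty →
      (∀ a ∈ A, ∀ b ∈ B, a (P.run a b) ≠ b (P.run a b)) →
      ∃ (F : (ι → Bool) → Bool) (s : ℕ), CktSize B2 (fun x (_ : Unit) => F x) s ∧
        s + 1 ≤ 2 ^ (P.depth + 1) ∧ (∀ a ∈ A, F a = true) ∧ (∀ b ∈ B, F b = false) := by
  intro P
  induction P with
  | leaf i =>
    intro A B hA hB hrun
    obtain ⟨a₀, ha₀⟩ := hA
    obtain ⟨b₀, hb₀⟩ := hB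
    have hAi : ∀ a ∈ A, a i = a₀ i := fun a ha => by
      have h1 := hrun a ha b₀ hb₀
      have h2 := hrun a₀ ha₀ b₀ hb₀
      change a i ≠ b₀ i at h1
      change a₀ i ≠ b₀ i at h2
      revert h1 h2
      cases a i <;> cases a₀ i <;> cases b₀ i <;> decide
    have hBi : ∀ b ∈ B, b i = !a₀ i := fun b hb => by
      have h1 := hrun a₀ ha₀ b hb
      change a₀ i ≠ b i at h1
      revert h1
      cases a₀ i <;> cases b i <;> decide
    cases h0 : a₀ i
    · -- `a₀ i = 0`: the literal `¬x_i`
      refine ⟨fun x => !x i, 1, cktSize_not i, by simp [depth], fun a ha => ?_, fun b hb => ?_⟩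
      · show (!a i) = true
        rw [hAi a ha, h0]
        rfl
      · show (!b i) = false
        rw [hBi b hb, h0]
        rfl
    · -- `a₀ i = 1`: the literal `x_i`
      refine ⟨fun x => x i, 0, CktSize.proj B2 (fun _ : Unit => i), by simp [depth],
        fun a ha => ?_, fun b hb => ?_⟩
      · show a i = true
        rw [hAi a ha, h0]
      · show b i = false
        rw [hBi b hb, h0]
        rfl
  | alice s P Q ihP ihQ =>
    intro A B hA hB hrun
    have hrun₀ : ∀ a ∈ A ∩ {a | s a = false}, ∀ b ∈ B, a (P.run a b) ≠ b (P.run a b) := by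
      rintro a ⟨ha, (hs : s a = false)⟩ b hb
      simpa [hs] using hrun a ha b hb
    have hrun₁ : ∀ a ∈ A ∩ {a | s a = true}, ∀ b ∈ B, a (Q.run a b) ≠ b (Q.run a b) := by
      rintro a ⟨ha, (hs : s a = true)⟩ b hb
      simpa [hs] using hrun a ha b hb
    have h1 : 2 ^ (P.depth + 1) ≤ 2 ^ (max P.depth Q.depth + 1) :=
      Nat.pow_le_pow_right (by norm_num) (by omega)
    have h2 : 2 ^ (Q.depth + 1) ≤ 2 ^ (max P.depth Q.depth + 1) :=
      Nat.pow_le_pow_right (by norm_num) (by omega)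
    by_cases hA₀ : (A ∩ {a | s a = false}).Nonempty
    · by_cases hA₁ : (A ∩ {a | s a = true}).Nonempty
      · -- both sub-rectangles inhabited: `F₀ ∨ F₁`
        obtain ⟨F₀, s₀, hc₀, hs₀, hT₀, hf₀⟩ := ihP _ _ hA₀ hB hrun₀
        obtain ⟨F₁, s₁, hc₁, hs₁, hT₁, hf₁⟩ := ihQ _ _ hA₁ hB hrun₁
        have hc : CktSize B2 (fun x (_ : Unit) => (F₀ x || F₁ x)) (s₀ + s₁ + 1) :=
          ((hc₀.pair hc₁).comp (cktSize_or (ι := Unit ⊕ Unit) (Sum.inl ()) (Sum.inr ()))).congr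
            fun _ _ => rfl
        refine ⟨fun x => (F₀ x || F₁ x), s₀ + s₁ + 1, hc, ?_, ?_, ?_⟩
        · simp only [depth_alice, pow_succ] at h1 h2 hs₀ hs₁ ⊢
          omega
        · intro a ha
          show (F₀ a || F₁ a) = true
          rw [Bool.or_eq_true]
          cases hsa : s a
          · exact Or.inl (hT₀ a ⟨ha, hsa⟩)
          · exact Or.inr (hT₁ a ⟨ha, hsa⟩)
        · intro b hb
          show (F₀ b || F₁ b) = false
          rw [hf₀ b hb, hf₁ b hb, Bool.or_false]
      · -- `A₁ = ∅`: Alice's bit is `0` on all of `A`, the subtree `P` handles `A × B`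
        have hall : ∀ a ∈ A, s a = false := fun a ha => by
          cases hsa : s a
          · rfl
          · exact (hA₁ ⟨a, ha, hsa⟩).elim
        obtain ⟨F, s', hc, hs, hT, hf⟩ :=
          ihP A B hA hB fun a ha b hb => hrun₀ a ⟨ha, hall a ha⟩ b hb
        refine ⟨F, s', hc, ?_, hT, hf⟩
        simp only [depth_alice, pow_succ] at h1 hs ⊢
        omega
    · -- `A₀ = ∅`: Alice's bit is `1` on all of `A`, the subtree `Q` handles `A × B`
      have hall : ∀ a ∈ A, s a = true := fun a ha => by
        cases hsa : s a
        · exact (hA₀ ⟨a, ha, hsa⟩).elim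
        · rfl
      obtain ⟨F, s', hc, hs, hT, hf⟩ :=
        ihQ A B hA hB fun a ha b hb => hrun₁ a ⟨ha, hall a ha⟩ b hb
      refine ⟨F, s', hc, ?_, hT, hf⟩
      simp only [depth_alice, pow_succ] at h2 hs ⊢
      omega
  | bob s P Q ihP ihQ =>
    intro A B hA hB hrun
    have hrun₀ : ∀ a ∈ A, ∀ b ∈ B ∩ {b | s b = false}, a (P.run a b) ≠ b (P.run a b) := by
      rintro a ha b ⟨hb, (hs : s b = false)⟩
      simpa [hs] using hrun a ha b hb
    have hrun₁ : ∀ a ∈ A, ∀ b ∈ B ∩ {b | s b = true}, a (Q.run a b) ≠ b (Q.run a b) := by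
      rintro a ha b ⟨hb, (hs : s b = true)⟩
      simpa [hs] using hrun a ha b hb
    have h1 : 2 ^ (P.depth + 1) ≤ 2 ^ (max P.depth Q.depth + 1) :=
      Nat.pow_le_pow_right (by norm_num) (by omega)
    have h2 : 2 ^ (Q.depth + 1) ≤ 2 ^ (max P.depth Q.depth + 1) :=
      Nat.pow_le_pow_right (by norm_num) (by omega)
    by_cases hB₀ : (B ∩ {b | s b = false}).Nonempty
    · by_cases hB₁ : (B ∩ {b | s b = true}).Nonempty
      · -- both sub-rectangles inhabited: `F₀ ∧ F₁`
        obtain ⟨F₀, s₀, hc₀, hs₀, hT₀, hf₀⟩ := ihP _ _ hA hB₀ hrun₀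
        obtain ⟨F₁, s₁, hc₁, hs₁, hT₁, hf₁⟩ := ihQ _ _ hA hB₁ hrun₁
        have hc : CktSize B2 (fun x (_ : Unit) => (F₀ x && F₁ x)) (s₀ + s₁ + 1) :=
          ((hc₀.pair hc₁).comp (cktSize_and (ι := Unit ⊕ Unit) (Sum.inl ()) (Sum.inr ()))).congr
            fun _ _ => rfl
        refine ⟨fun x => (F₀ x && F₁ x), s₀ + s₁ + 1, hc, ?_, ?_, ?_⟩
        · simp only [depth_bob, pow_succ] at h1 h2 hs₀ hs₁ ⊢
          omega
        · intro a ha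
          show (F₀ a && F₁ a) = true
          rw [hT₀ a ha, hT₁ a ha, Bool.and_true]
        · intro b hb
          show (F₀ b && F₁ b) = false
          rw [Bool.and_eq_false_iff]
          cases hsb : s b
          · exact Or.inl (hf₀ b ⟨hb, hsb⟩)
          · exact Or.inr (hf₁ b ⟨hb, hsb⟩)
      · -- `B₁ = ∅`
        have hall : ∀ b ∈ B, s b = false := fun b hb => by
          cases hsb : s b
          · rfl
          · exact (hB₁ ⟨b, hb, hsb⟩).elim
        obtain ⟨F, s', hc, hs, hT, hf⟩ :=
          ihP A B hA hB fun a ha b hb => hrun₀ a ha b ⟨hb, hall b hb⟩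
        refine ⟨F, s', hc, ?_, hT, hf⟩
        simp only [depth_bob, pow_succ] at h1 hs ⊢
        omega
    · -- `B₀ = ∅`
      have hall : ∀ b ∈ B, s b = true := fun b hb => by
        cases hsb : s b
        · exact (hB₀ ⟨b, hb, hsb⟩).elim
        · rfl
      obtain ⟨F, s', hc, hs, hT, hf⟩ :=
        ihQ A B hA hB fun a ha b hb => hrun₁ a ha b ⟨hb, hall b hb⟩
      refine ⟨F, s', hc, ?_, hT, hf⟩
      simp only [depth_bob, pow_succ] at h2 hs ⊢
      omega

/-- **Karchmer–Wigderson, protocol ⟹ circuit** (easy direction of `d(f) = C(R_f)`, Jukna 2012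
Thm. 3.13): a protocol tree of depth `D` solving the Karchmer–Wigderson game of a function `h`
taking both values yields a circuit over the binary basis `B2` computing `h` with at most
`2^{D+1} − 1` gates (literals cost one negation gate each).
[cite: JuknaBFC2012, §3.3, Thm. 3.13] [cite: KarchmerWigderson1990, §2, Thm. (d(f) = C(R_f))] -/
theorem exists_circuit_of_solves (P : KWTree ι) {h : (ι → Bool) → Bool} (hP : P.Solves h)
    (h1 : ∃ a, h a = true) (h0 : ∃ b, h b = false) :
    ∃ C : Circuit ι, C.IsOver B2 ∧ C.Computes h ∧ C.size + 1 ≤ 2 ^ (P.depth + 1) := by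
  obtain ⟨F, s, hF, hs, hT, hf⟩ := exists_cktSize_of_rectangle P {a | h a = true}
    {b | h b = false} h1 h0 fun a ha b hb => hP a b ha hb
  obtain ⟨C, hO, hsize, hev⟩ := hF.toCircuit
  refine ⟨C, hO, fun x => ?_, by omega⟩
  rw [hev]
  cases hx : h x
  · exact hf x hx
  · exact hT x hx

/-- **Protocol depth bounds `B2`-circuit complexity**: if a protocol tree `P` solves the
Karchmer–Wigderson game of a non-constant `h` then `circuitSizeOver B2 h < 2^{depth P + 1}`.
[cite: JuknaBFC2012, §3.3, Thm. 3.13] -/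
theorem circuitSizeOver_B2_lt_two_pow_of_solves (P : KWTree ι) {h : (ι → Bool) → Bool}
    (hP : P.Solves h) (h1 : ∃ a, h a = true) (h0 : ∃ b, h b = false) :
    circuitSizeOver B2 h < 2 ^ (P.depth + 1) := by
  obtain ⟨C, hO, hC, hs⟩ := P.exists_circuit_of_solves hP h1 h0
  have := circuitSizeOver_le_of_computes C hO hC
  omega

end KWTree

/-! ### §2 Counting: few small circuits against many functions -/

/-- Constants have `B2`-circuit complexity at most `1` (one arity-`0` gate, Vollmer 1999, §1.1).
[cite: Vollmer1999, §1.1] -/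
theorem circuitSizeOver_B2_const_le (ι : Type*) (b : Bool) :
    circuitSizeOver B2 (fun _ : ι → Bool => b) ≤ 1 := by
  refine (circuitSizeOver_le_of_computes (Circuit.const ι b) ?_ fun x => Circuit.eval_const b x).trans
    (by rw [Circuit.size_const])
  intro g hg
  simp only [Circuit.const, List.mem_singleton] at hg
  subst hg
  exact const_mem_B2 b

/-- `⌊log₂ n⌋ + 6 ≤ n` for `n ≥ 9`. [folklore] -/
private theorem log_two_add_six_le {n : ℕ} (hn : 9 ≤ n) : Nat.log 2 n + 6 ≤ n := by
  have key : ∀ m : ℕ, 9 + m < 2 ^ (m + 4) := by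
    intro m
    induction m with
    | zero => norm_num
    | succ m ih => rw [pow_succ]; omega
  obtain ⟨m, rfl⟩ : ∃ m, n = 9 + m := ⟨n - 9, by omega⟩
  have hlt : Nat.log 2 (9 + m) < m + 4 := Nat.log_lt_of_lt_pow (by omega) (key m)
  omega

/-- **Riordan–Shannon count, circuit form** (Jukna 2012, Thm. 1.23; here via the tree's
`CircuitCount.card_code_le`): for `n ≥ 9` and `S + 2 = 2^{n − ⌊log₂ n⌋ − 4}` there are fewer
codes of `B2`-circuits of size `≤ S` on `n` inputs than Boolean functions: `#Code n S < 2^{2ⁿ}`.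
[cite: JuknaBFC2012, Thm. 1.23 (Riordan–Shannon)] -/
theorem card_code_lt_two_pow_two_pow {n S : ℕ} (hn : 9 ≤ n)
    (hS : S + 2 = 2 ^ (n - (Nat.log 2 n + 4))) :
    Fintype.card (CircuitCount.Code n S) < 2 ^ 2 ^ n := by
  set t := Nat.log 2 n + 4 with ht
  have htn : t + 2 ≤ n := by have := log_two_add_six_le hn; omega
  set M := n + S + 1 with hM
  -- `#Code ≤ (S+1) (16 M²)^S M ≤ (16 M²)^(S+1)`
  have h16 : (S + 1) * M ≤ 16 * M ^ 2 := by nlinarith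
  have hcard : Fintype.card (CircuitCount.Code n S) ≤ (16 * M ^ 2) ^ (S + 1) := by
    calc Fintype.card (CircuitCount.Code n S)
        ≤ (S + 1) * (16 * M ^ 2) ^ S * M := CircuitCount.card_code_le n S
      _ = (16 * M ^ 2) ^ S * ((S + 1) * M) := by ring
      _ ≤ (16 * M ^ 2) ^ S * (16 * M ^ 2) := Nat.mul_le_mul_left _ h16
      _ = (16 * M ^ 2) ^ (S + 1) := by ring
  -- `M ≤ 2ⁿ`, so `16 M² ≤ 2^(2n+4)`
  have hS1 : S + 2 ≤ 2 ^ (n - 1) := by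
    rw [hS]; exact Nat.pow_le_pow_right (by norm_num) (by omega)
  have hn1 : n ≤ 2 ^ (n - 1) := by
    have := Nat.lt_two_pow_self (n := n - 1)
    have h2 : 2 ^ n = 2 * 2 ^ (n - 1) := by
      rw [← pow_succ']; congr 1; omega
    omega
  have hMle : M ≤ 2 ^ n := by
    have h2 : 2 ^ n = 2 * 2 ^ (n - 1) := by
      rw [← pow_succ']; congr 1; omega
    omega
  have h16M : 16 * M ^ 2 ≤ 2 ^ (2 * n + 4) := by
    have : 2 ^ (2 * n + 4) = 16 * (2 ^ n) ^ 2 := by ring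
    rw [this]
    gcongr
  -- the exponent `(2n+4)(S+1) < 2ⁿ`
  have hlog : n < 2 ^ (Nat.log 2 n + 1) := Nat.lt_pow_succ_log_self (by norm_num) n
  have h2n4 : 2 * n + 4 ≤ 2 ^ (t - 1) := by
    have : 2 ^ (t - 1) = 4 * 2 ^ (Nat.log 2 n + 1) := by
      rw [ht, show Nat.log 2 n + 4 - 1 = (Nat.log 2 n + 1) + 2 by omega, pow_add]; ring
    omega
  have hexp : (2 * n + 4) * (S + 1) < 2 ^ n := by
    have hS' : S + 1 < 2 ^ (n - t) := by omega
    calc (2 * n + 4) * (S + 1) ≤ 2 ^ (t - 1) * (S + 1) := Nat.mul_le_mul_right _ h2n4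
      _ < 2 ^ (t - 1) * 2 ^ (n - t) := Nat.mul_lt_mul_of_pos_left hS' (by positivity)
      _ = 2 ^ (n - 1) := by rw [← pow_add]; congr 1; omega
      _ ≤ 2 ^ n := Nat.pow_le_pow_right (by norm_num) (by omega)
  calc Fintype.card (CircuitCount.Code n S) ≤ (16 * M ^ 2) ^ (S + 1) := hcard
    _ ≤ (2 ^ (2 * n + 4)) ^ (S + 1) := Nat.pow_le_pow_left h16M _
    _ = 2 ^ ((2 * n + 4) * (S + 1)) := by rw [← pow_mul]
    _ < 2 ^ 2 ^ n := Nat.pow_lt_pow_right (by norm_num) hexp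

/-! ### §3 Assembly -/

/-- **Depth-hard functions exist** — discharge of `DepthHardFunctionsExist` with the constant
`c = 8`: for `n ≥ 9` take the greedy hard function `g = GreedyHard.hardFn n S`,
`S + 2 = 2^{n − ⌊log₂ n⌋ − 4}`; by §2 no `B2`-circuit of size `≤ S` computes `g` (so `g` is not
constant), and by §1 a protocol of depth `d` for its Karchmer–Wigderson game would give one of size
`≤ 2^{d+1} − 2` unless `S + 2 ≤ 2^{d+1}`, i.e. `n ≤ d + ⌊log₂ n⌋ + 5`; for `n ≤ 8` the bound
`n ≤ 8 (⌊log₂ n⌋ + 1)` is trivial. [cite: JuknaBFC2012, Thm. 1.23 (Riordan–Shannon) and Thm. 3.13, Claim 3.15 (protocol to formula)] -/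
theorem DepthHardFunctionsExist_holds : DepthHardFunctionsExist := by
  refine ⟨8, fun n hn => ?_⟩
  by_cases hsmall : n ≤ 8
  · exact ⟨fun _ => true, fun P _ => by nlinarith [Nat.zero_le (Nat.log 2 n), Nat.zero_le P.depth]⟩
  have hn9 : 9 ≤ n := by omega
  set t := Nat.log 2 n + 4 with ht
  have htn : t + 2 ≤ n := by have := log_two_add_six_le hn9; omega
  have hpow2 : 4 ≤ 2 ^ (n - t) := by
    calc (4 : ℕ) = 2 ^ 2 := by norm_num
      _ ≤ 2 ^ (n - t) := Nat.pow_le_pow_right (by norm_num) (by omega)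
  set S := 2 ^ (n - t) - 2 with hSdef
  have hS : S + 2 = 2 ^ (n - (Nat.log 2 n + 4)) := by rw [← ht]; omega
  have hcard := card_code_lt_two_pow_two_pow hn9 hS
  have hlt : S < circuitSizeOver B2 (GreedyHard.hardFn n S) :=
    GreedyHard.lt_circuitSizeOver_hardFn hcard
  refine ⟨GreedyHard.hardFn n S, fun P hP => ?_⟩
  set g := GreedyHard.hardFn n S with hg
  -- `g` is not constant: constants have circuits of size `1 ≤ S`
  have hS2 : 2 ≤ S := by omega
  have hne : (∃ a, g a = true) ∧ ∃ b, g b = false := by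
    by_contra hcon
    have hconst : ∃ b : Bool, g = fun _ => b := by
      by_cases h1 : ∃ a, g a = true
      · refine ⟨true, funext fun x => ?_⟩
        by_contra hx
        exact hcon ⟨h1, x, by simpa using hx⟩
      · refine ⟨false, funext fun x => ?_⟩
        by_contra hx
        exact h1 ⟨x, by simpa using hx⟩
    obtain ⟨b, hb⟩ := hconst
    have h1 : circuitSizeOver B2 g ≤ 1 := by rw [hb]; exact circuitSizeOver_B2_const_le _ b
    omega
  have hdepth := P.circuitSizeOver_B2_lt_two_pow_of_solves hP hne.1 hne.2
  have hle : 2 ^ (n - t) ≤ 2 ^ (P.depth + 1) := by omega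
  have hnt : n - t ≤ P.depth + 1 := (Nat.pow_le_pow_iff_right (by norm_num)).mp hle
  omega

end Literature.Computability.Complexity
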